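import Summits.CriticalPhenomena.PercolationContinuityZ3.Theorems.PercNonProliferationSubpolynomialBlockingStubUpperSandwich
import Summits.CriticalPhenomena.PercolationContinuityZ3.Theorems.PercNonProliferationSubpolynomialBlockingStubSixSlab
import Summits.CriticalPhenomena.PercolationContinuityZ3.Theorems.PercNonProliferationSubpolynomialBlockingStubTiling

/-!
# `SubpolynomialBlocking` — negative knowledge V: the flat seed is NECESSARY too (`u_n ≤ seed_k(n)⁶`, `k ≥ 2`),
so the line's transfer target `SeedSubpoly k` is EQUIVALENT to the crux for `k ≥ 2`

Support file for crux item stmt-CriticalPhenomena-4446 (`PercNonProliferation.SubpolynomialBlocking`), by the deep refuter of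
line `cross-sandwich-flat-seal` (refuter-drefute-stmt-CriticalPhenomena-4446-g2-0). The lead's landed necessity certificate
`stub_upperSandwich` (`u_n ≤ q_n⁶`: six vertex-disjoint CUBES in the shell) is repeated with six vertex-disjoint FLAT SEEDS
`σ_{i,s}([n,2n] × [1-n, 1+⌊n/k⌋]²)`, which fit in the shell and are pairwise disjoint as soon as `⌊n/k⌋ + 2 ≤ n`
(`k ≥ 2`, `n ≥ 3`):

* `blockProb_le_seed_pow_six` — `u_n ≤ seed_k(n)⁶` for `k ≥ 2`, `n ≥ 3` (seed = the registered `stub_comparison`/`stub_tiling`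
  object `P_{p_c}(seal of [0,n] × [0,n+⌊n/k⌋]² across direction 0)`);
* `seedSubpoly_of_crux` — the crux implies `∀ s > 0, ∀ᶠ n, n^{-s} ≤ seed_k(n)` for every `k ≥ 2`;
* `crux_iff_seedSubpoly` — with the landed `stub_sixSlab` + `stub_tiling` (which give the converse for every `k ≥ 1`),
  **`SubpolynomialBlocking ↔ SeedSubpoly k` for every `k ≥ 2`**: the line's "Transfer" statement is the crux restated, and the
  only genuine cut of the line is `stub_comparison ∧ stub_anchor` (drefute g2 report, §7).

No Theses statement is asserted positively (the `↔` and `→ crux` directions are compositions of LANDED theorems).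
-/

noncomputable section

namespace Summit.CriticalPhenomena.PercolationContinuityZ3.Theorems.SubpolynomialBlocking

open MeasureTheory Filter Topology ProbabilityTheory
open Literature.Probability.Percolation Literature.Probability.LatticeModels
open Literature.Probability.Percolation.DCT16
open Literature.Barriers.CriticalPhenomena
open Summit.CriticalPhenomena.PercolationContinuityZ3.Theorems.SubpolynomialBlocking.Negative
open Summit.CriticalPhenomena.PercolationContinuityZ3.Theses

namespace SeedSandwich

/-! ### Geometry of the six flat seeds `σ_{i,s}([n,2n] × [1-n, 1+q]²)`, `q + 2 ≤ n` -/

/-- Membership in the seed box `[0,n] × [0,n+q]²`, coordinatewise. -/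
theorem mem_seed_iff {n q : ℕ} {x : Site 3} :
    x ∈ Set.Icc (0 : Site 3) ![(n : ℤ), (n : ℤ) + (q : ℕ), (n : ℤ) + (q : ℕ)] ↔
      (0 ≤ x 0 ∧ 0 ≤ x 1 ∧ 0 ≤ x 2) ∧ (x 0 ≤ n ∧ x 1 ≤ n + q ∧ x 2 ≤ n + q) := by
  simp [Set.mem_Icc, Pi.le_def, Fin.forall_fin_succ]

/-- The shifted seed `[n,2n] × [1-n, 1+q]²` lies in `Λ_{2n}` (`q + 2 ≤ n`). -/
theorem shift_mem_box_two_mul {n q : ℕ} (hq : q + 2 ≤ n) {x : Site 3}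
    (hx : x ∈ Set.Icc (0 : Site 3) ![(n : ℤ), (n : ℤ) + (q : ℕ), (n : ℤ) + (q : ℕ)]) :
    x + ![(n : ℤ), 1 - (n : ℤ), 1 - (n : ℤ)] ∈ box 3 (2 * n) := by
  rw [mem_seed_iff] at hx
  rw [mem_box]
  intro j
  fin_cases j <;> simp only [Pi.add_apply] <;> simp <;> omega

/-- The inner face `{n} × [1-n, 1+q]²` of the shifted seed lies in `Λ_n` (`q + 2 ≤ n`). -/
theorem shift_mem_box_of_face {n q : ℕ} (hq : q + 2 ≤ n) {x : Site 3}
    (hx : x ∈ Set.Icc (0 : Site 3) ![(n : ℤ), (n : ℤ) + (q : ℕ), (n : ℤ) + (q : ℕ)]) (h0 : x 0 = 0) :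
    x + ![(n : ℤ), 1 - (n : ℤ), 1 - (n : ℤ)] ∈ box 3 n := by
  rw [mem_seed_iff] at hx
  rw [mem_box]
  intro j
  fin_cases j <;> simp only [Pi.add_apply] <;> simp <;> omega

/-- Each of the six seeds lies in `Λ_{2n}`. -/
theorem image_seed_subset_box {n q : ℕ} (hq : q + 2 ≤ n) (i : Fin 3) (s : ℤˣ) :
    zdSignedPermIso (Equiv.swap (0 : Fin 3) i) (fun _ => s) ''
        (zdShiftIso (![(n : ℤ), 1 - (n : ℤ), 1 - (n : ℤ)] : Site 3) ''
          Set.Icc (0 : Site 3) ![(n : ℤ), (n : ℤ) + (q : ℕ), (n : ℤ) + (q : ℕ)]) ⊆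
      (↑(box 3 (2 * n)) : Set (Site 3)) := by
  rintro _ ⟨y, ⟨x, hx, rfl⟩, rfl⟩
  exact (signedPerm_mem_box_iff _ _).2 (shift_mem_box_two_mul hq hx)

/-- The inner face of each of the six seeds lies in `Λ_n`. -/
theorem image_innerFace_subset_box {n q : ℕ} (hq : q + 2 ≤ n) (i : Fin 3) (s : ℤˣ) :
    zdSignedPermIso (Equiv.swap (0 : Fin 3) i) (fun _ => s) ''
        (zdShiftIso (![(n : ℤ), 1 - (n : ℤ), 1 - (n : ℤ)] : Site 3) ''
          {x | x ∈ Set.Icc (0 : Site 3) ![(n : ℤ), (n : ℤ) + (q : ℕ), (n : ℤ) + (q : ℕ)] ∧ x 0 = 0}) ⊆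
      (↑(box 3 n) : Set (Site 3)) := by
  rintro _ ⟨y, ⟨x, ⟨hx, h0⟩, rfl⟩, rfl⟩
  exact (signedPerm_mem_box_iff _ _).2 (shift_mem_box_of_face hq hx h0)

/-- The outer face of each of the six seeds lies on `∂ⁱⁿΛ_{2n}`. -/
theorem image_outerFace_subset_innerBoundary {n q : ℕ} (hq : q + 2 ≤ n) (i : Fin 3) (s : ℤˣ) :
    zdSignedPermIso (Equiv.swap (0 : Fin 3) i) (fun _ => s) ''
        (zdShiftIso (![(n : ℤ), 1 - (n : ℤ), 1 - (n : ℤ)] : Site 3) ''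
          {y | y ∈ Set.Icc (0 : Site 3) ![(n : ℤ), (n : ℤ) + (q : ℕ), (n : ℤ) + (q : ℕ)] ∧ y 0 = (n : ℤ)}) ⊆
      (↑(innerBoundary (zdGraph 3) (box 3 (2 * n))) : Set (Site 3)) := by
  rintro _ ⟨y, ⟨x, ⟨hx, h0⟩, rfl⟩, rfl⟩
  refine mem_innerBoundary_box_of_natAbs_eq (i := i)
    ((signedPerm_mem_box_iff _ _).2 (shift_mem_box_two_mul hq hx)) ?_
  simp only [zdSignedPermIso_apply, Site.signedPerm_apply, Equiv.symm_swap, Equiv.swap_apply_right,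
    zdShiftIso_apply, Pi.add_apply, Matrix.cons_val_zero, h0, Int.natAbs_mul, Int.units_natAbs,
    one_mul]
  omega

/-- Along its own axis `i`, the seed `(i, s)` has `|z_i| ≥ n` and `s z_i > 0`. -/
theorem natAbs_apply_self_of_mem_image {n q : ℕ} (hq : q + 2 ≤ n) (i : Fin 3) (s : ℤˣ) {z : Site 3}
    (hz : z ∈ zdSignedPermIso (Equiv.swap (0 : Fin 3) i) (fun _ => s) ''
        (zdShiftIso (![(n : ℤ), 1 - (n : ℤ), 1 - (n : ℤ)] : Site 3) ''
          Set.Icc (0 : Site 3) ![(n : ℤ), (n : ℤ) + (q : ℕ), (n : ℤ) + (q : ℕ)])) :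
    n ≤ (z i).natAbs ∧ 0 < (s : ℤ) * z i := by
  obtain ⟨y, ⟨x, hx, rfl⟩, rfl⟩ := hz
  rw [mem_seed_iff] at hx
  simp only [zdSignedPermIso_apply, Site.signedPerm_apply, Equiv.symm_swap, Equiv.swap_apply_right,
    zdShiftIso_apply, Pi.add_apply, Matrix.cons_val_zero, ← mul_assoc, Int.units_coe_mul_self,
    one_mul, Int.natAbs_mul, Int.units_natAbs]
  omega

/-- Across its axis, the seed `(i, s)` has `|z_j| + 1 ≤ n` for `j ≠ i` (`q + 2 ≤ n`). -/
theorem natAbs_apply_ne_of_mem_image {n q : ℕ} (hq : q + 2 ≤ n) (i : Fin 3) (s : ℤˣ) {z : Site 3}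
    (hz : z ∈ zdSignedPermIso (Equiv.swap (0 : Fin 3) i) (fun _ => s) ''
        (zdShiftIso (![(n : ℤ), 1 - (n : ℤ), 1 - (n : ℤ)] : Site 3) ''
          Set.Icc (0 : Site 3) ![(n : ℤ), (n : ℤ) + (q : ℕ), (n : ℤ) + (q : ℕ)]))
    {j : Fin 3} (hj : j ≠ i) : (z j).natAbs + 1 ≤ n := by
  obtain ⟨y, ⟨x, hx, rfl⟩, rfl⟩ := hz
  rw [mem_seed_iff] at hx
  have hc : Equiv.swap (0 : Fin 3) i j ≠ 0 := by
    rw [Ne, Equiv.swap_apply_eq_iff, Equiv.swap_apply_left]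
    exact hj
  generalize hc' : Equiv.swap (0 : Fin 3) i j = c at hc
  simp only [zdSignedPermIso_apply, Site.signedPerm_apply, Equiv.symm_swap, hc', zdShiftIso_apply,
    Pi.add_apply, Int.natAbs_mul, Int.units_natAbs, one_mul]
  fin_cases c
  · exact absurd rfl hc
  · simp; omega
  · simp; omega

/-- The six seeds are pairwise vertex-disjoint (`q + 2 ≤ n`). -/
theorem pairwise_disjoint_image_seed {n q : ℕ} (hq : q + 2 ≤ n) :
    Pairwise fun k l : Fin 3 × ℤˣ => Disjoint
      (zdSignedPermIso (Equiv.swap (0 : Fin 3) k.1) (fun _ => k.2) ''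
        (zdShiftIso (![(n : ℤ), 1 - (n : ℤ), 1 - (n : ℤ)] : Site 3) ''
          Set.Icc (0 : Site 3) ![(n : ℤ), (n : ℤ) + (q : ℕ), (n : ℤ) + (q : ℕ)]))
      (zdSignedPermIso (Equiv.swap (0 : Fin 3) l.1) (fun _ => l.2) ''
        (zdShiftIso (![(n : ℤ), 1 - (n : ℤ), 1 - (n : ℤ)] : Site 3) ''
          Set.Icc (0 : Site 3) ![(n : ℤ), (n : ℤ) + (q : ℕ), (n : ℤ) + (q : ℕ)])) := by
  rintro ⟨i, s⟩ ⟨j, t⟩ hkl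
  rw [Set.disjoint_left]
  intro z hz hz'
  by_cases hij : i = j
  · subst hij
    have hst : s ≠ t := fun h => hkl (by rw [h])
    have h1 := (natAbs_apply_self_of_mem_image hq i s hz).2
    have h2 := (natAbs_apply_self_of_mem_image hq i t hz').2
    rw [Int.units_ne_iff_eq_neg] at hst
    subst hst
    rw [Units.val_neg, neg_mul] at h1
    omega
  · have h1 := (natAbs_apply_self_of_mem_image hq i s hz).1
    have h2 := natAbs_apply_ne_of_mem_image hq j t hz' hij
    omega

/-- `⌊n/k⌋ + 2 ≤ n` for `k ≥ 2`, `n ≥ 3`. -/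
theorem div_add_two_le {k n : ℕ} (hk : 2 ≤ k) (hn : 3 ≤ n) : n / k + 2 ≤ n := by
  have h1 : n / k ≤ n / 2 := Nat.div_le_div_left hk (by norm_num)
  have h2 : n / 2 + 2 ≤ n := by omega
  omega

end SeedSandwich

open SeedSandwich in
/-- **`u_n ≤ seed_k(n)⁶` for `k ≥ 2`, `n ≥ 3`** — the flat seed of line `cross-sandwich-flat-seal` is NECESSARY for the crux
exactly as the cube is (`stub_upperSandwich`): the blocking event lies in the sealing event of each of the six pairwise
vertex-disjoint seeds `σ_{i,s}([n,2n] × [1-n, 1+⌊n/k⌋]²)` of the shell (inner face in `Λ_n`, outer face on `∂ⁱⁿΛ_{2n}`),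
which are independent (disjoint edge sets) and each has the probability `seed_k(n)` of sealing `[0,n] × [0,n+⌊n/k⌋]²`
(lattice symmetry). -/
theorem blockProb_le_seed_pow_six {k n : ℕ} (hk : 2 ≤ k) (hn : 3 ≤ n) :
    blockProb 3 (criticalProbI 3) n ≤
      (bondPercolation (zdGraph 3) (criticalProbI 3)).real
        (openCrossing (Set.Icc (0 : Site 3) ![(n : ℤ), (n : ℤ) + (n / k : ℕ), (n : ℤ) + (n / k : ℕ)])
          {x | x ∈ Set.Icc (0 : Site 3) ![(n : ℤ), (n : ℤ) + (n / k : ℕ), (n : ℤ) + (n / k : ℕ)] ∧ x 0 = 0}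
          {y | y ∈ Set.Icc (0 : Site 3) ![(n : ℤ), (n : ℤ) + (n / k : ℕ), (n : ℤ) + (n / k : ℕ)] ∧
            y 0 = (n : ℤ)})ᶜ ^ 6 := by
  have hq : n / k + 2 ≤ n := div_add_two_le hk hn
  generalize n / k = q at hq ⊢
  set C : Set (Site 3) := Set.Icc (0 : Site 3) ![(n : ℤ), (n : ℤ) + (q : ℕ), (n : ℤ) + (q : ℕ)]
  set A : Set (Site 3) := {x | x ∈ Set.Icc (0 : Site 3) ![(n : ℤ), (n : ℤ) + (q : ℕ), (n : ℤ) + (q : ℕ)] ∧ x 0 = 0}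
  set B : Set (Site 3) :=
    {y | y ∈ Set.Icc (0 : Site 3) ![(n : ℤ), (n : ℤ) + (q : ℕ), (n : ℤ) + (q : ℕ)] ∧ y 0 = (n : ℤ)}
  set τ : zdGraph 3 ≃g zdGraph 3 := zdShiftIso (![(n : ℤ), 1 - (n : ℤ), 1 - (n : ℤ)] : Site 3)
  set ψ : Fin 3 × ℤˣ → zdGraph 3 ≃g zdGraph 3 :=
    fun k => zdSignedPermIso (Equiv.swap (0 : Fin 3) k.1) (fun _ => k.2)
  set μ := bondPercolation (zdGraph 3) (criticalProbI 3) with hμ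
  -- (a) blocking ⊆ each seal
  have hsub : (annulusCrossing 3 n)ᶜ ⊆
      ⋂ k, (openCrossing (ψ k '' (τ '' C)) (ψ k '' (τ '' A)) (ψ k '' (τ '' B)))ᶜ := by
    refine Set.subset_iInter fun k => Set.compl_subset_compl.2 ?_
    exact StubUpperSandwich.openCrossing_subset_annulusCrossing (image_seed_subset_box hq k.1 k.2)
      (image_innerFace_subset_box hq k.1 k.2) (image_outerFace_subset_innerBoundary hq k.1 k.2)
  -- (b) independence
  have hprod : μ.real (⋂ k, (openCrossing (ψ k '' (τ '' C)) (ψ k '' (τ '' A)) (ψ k '' (τ '' B)))ᶜ) =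
      ∏ k, μ.real (openCrossing (ψ k '' (τ '' C)) (ψ k '' (τ '' A)) (ψ k '' (τ '' B)))ᶜ :=
    StubUpperSandwich.real_iInter_compl_openCrossing (zdGraph 3) (criticalProbI 3) (fun k => ψ k '' (τ '' C))
      (fun k => ψ k '' (τ '' A)) (fun k => ψ k '' (τ '' B)) (pairwise_disjoint_image_seed hq)
  -- (c) symmetry
  have hsymm : ∀ k, μ.real (openCrossing (ψ k '' (τ '' C)) (ψ k '' (τ '' A)) (ψ k '' (τ '' B)))ᶜ =
      μ.real (openCrossing C A B)ᶜ := fun k => by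
    rw [hμ, StubUpperSandwich.real_compl_openCrossing_image, StubUpperSandwich.real_compl_openCrossing_image]
  calc blockProb 3 (criticalProbI 3) n = μ.real (annulusCrossing 3 n)ᶜ := rfl
    _ ≤ μ.real (⋂ k, (openCrossing (ψ k '' (τ '' C)) (ψ k '' (τ '' A)) (ψ k '' (τ '' B)))ᶜ) :=
        measureReal_mono hsub
    _ = ∏ _k : Fin 3 × ℤˣ, μ.real (openCrossing C A B)ᶜ := by
        rw [hprod]; exact Finset.prod_congr rfl fun k _ => hsymm k
    _ = μ.real (openCrossing C A B)ᶜ ^ 6 := by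
        rw [Finset.prod_const, Finset.card_univ, Fintype.card_prod, Fintype.card_fin,
          Fintype.card_units_int]

/-- **The crux forces a sub-polynomial flat seed** (`k ≥ 2`): `SubpolynomialBlocking → ∀ s > 0, ∀ᶠ n, n^{-s} ≤ seed_k(n)`
(`n^{-6s} ≤ u_n ≤ seed_k(n)⁶`). -/
theorem seedSubpoly_of_crux {k : ℕ} (hk : 2 ≤ k) (h : PercNonProliferation.SubpolynomialBlocking) :
    ∀ s : ℝ, 0 < s → ∀ᶠ n : ℕ in atTop, (n : ℝ) ^ (-s) ≤
      (bondPercolation (zdGraph 3) (criticalProbI 3)).real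
        (openCrossing (Set.Icc (0 : Site 3) ![(n : ℤ), (n : ℤ) + (n / k : ℕ), (n : ℤ) + (n / k : ℕ)])
          {x | x ∈ Set.Icc (0 : Site 3) ![(n : ℤ), (n : ℤ) + (n / k : ℕ), (n : ℤ) + (n / k : ℕ)] ∧ x 0 = 0}
          {y | y ∈ Set.Icc (0 : Site 3) ![(n : ℤ), (n : ℤ) + (n / k : ℕ), (n : ℤ) + (n / k : ℕ)] ∧
            y 0 = (n : ℤ)})ᶜ := by
  rw [crux_iff, subpolynomialBlockingAt_iff] at h
  intro s hs
  filter_upwards [h (6 * s) (by positivity), eventually_ge_atTop 3] with n h1 hn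
  have hn0 : (0 : ℝ) ≤ n := Nat.cast_nonneg n
  have key : ((n : ℝ) ^ (-s)) ^ 6 ≤ _ ^ 6 :=
    calc ((n : ℝ) ^ (-s)) ^ 6 = (n : ℝ) ^ (-(6 * s)) := by
          rw [← Real.rpow_natCast, ← Real.rpow_mul hn0]; ring_nf
      _ ≤ blockProb 3 (criticalProbI 3) n := h1
      _ ≤ _ := blockProb_le_seed_pow_six hk hn
  exact le_of_pow_le_pow_left₀ (by norm_num) measureReal_nonneg key

/-! ### The converse from the LANDED front end (`stub_sixSlab`, `stub_tiling`), and the equivalence -/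

/-- Real-analysis glue (the lead's `exists_eventually_rpow_le`): for `s > 0` and a fixed power `M` there is `t > 0` with
`n^{-s} ≤ (n^{-t})^M` for all large `n`. -/
theorem exists_eventually_rpow_le_pow {s : ℝ} (hs : 0 < s) (M : ℕ) :
    ∃ t : ℝ, 0 < t ∧ ∀ᶠ n : ℕ in atTop, (n : ℝ) ^ (-s) ≤ ((n : ℝ) ^ (-t)) ^ M := by
  refine ⟨s / (M + 1), by positivity, ?_⟩
  filter_upwards [eventually_ge_atTop 1] with n hn
  have hn1 : (1 : ℝ) ≤ n := by exact_mod_cast hn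
  have hn0 : (0 : ℝ) < n := by linarith
  rw [← Real.rpow_natCast, ← Real.rpow_mul hn0.le]
  refine Real.rpow_le_rpow_of_exponent_le hn1 ?_
  have hM1 : (0 : ℝ) < M + 1 := by positivity
  have hM : (0 : ℝ) ≤ M := by positivity
  have key : s / (M + 1) * M ≤ s := by
    rw [div_mul_eq_mul_div, div_le_iff₀ hM1]
    nlinarith
  linarith

/-- **A sub-polynomial flat seed for ONE `k ≥ 1` gives the crux** — composition of the LANDED `stub_tiling` (`seed^K ≤ V`)
and `stub_sixSlab` (`V⁶ ≤ u`). -/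
theorem crux_of_seedSubpoly {k : ℕ} (hk : 1 ≤ k)
    (hS : ∀ s : ℝ, 0 < s → ∀ᶠ n : ℕ in atTop, (n : ℝ) ^ (-s) ≤
      (bondPercolation (zdGraph 3) (criticalProbI 3)).real
        (openCrossing (Set.Icc (0 : Site 3) ![(n : ℤ), (n : ℤ) + (n / k : ℕ), (n : ℤ) + (n / k : ℕ)])
          {x | x ∈ Set.Icc (0 : Site 3) ![(n : ℤ), (n : ℤ) + (n / k : ℕ), (n : ℤ) + (n / k : ℕ)] ∧ x 0 = 0}
          {y | y ∈ Set.Icc (0 : Site 3) ![(n : ℤ), (n : ℤ) + (n / k : ℕ), (n : ℤ) + (n / k : ℕ)] ∧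
            y 0 = (n : ℤ)})ᶜ) :
    PercNonProliferation.SubpolynomialBlocking := by
  rw [crux_iff, subpolynomialBlockingAt_iff]
  intro s hs
  obtain ⟨K, N, hKN⟩ := stub_tiling k hk
  obtain ⟨t, ht, hev⟩ := exists_eventually_rpow_le_pow hs (6 * K)
  filter_upwards [hev, hS t ht, eventually_ge_atTop (max N 1)] with n h1 h2 hn
  have hnN : N ≤ n := le_of_max_le_left hn
  have hn1 : 1 ≤ n := le_of_max_le_right hn
  have h0 : (0 : ℝ) ≤ (n : ℝ) ^ (-t) := Real.rpow_nonneg (Nat.cast_nonneg n) _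
  calc (n : ℝ) ^ (-s) ≤ ((n : ℝ) ^ (-t)) ^ (6 * K) := h1
    _ ≤ _ ^ (6 * K) := pow_le_pow_left₀ h0 h2 _
    _ = (_ ^ K) ^ 6 := by rw [pow_mul']
    _ ≤ _ ^ 6 := pow_le_pow_left₀ (pow_nonneg measureReal_nonneg K) (hKN n hnN) 6
    _ ≤ blockProb 3 (criticalProbI 3) n := stub_sixSlab n hn1

/-- **`SubpolynomialBlocking ↔ SeedSubpoly k` for every `k ≥ 2`**: the transfer target of line `cross-sandwich-flat-seal`
is equivalent to the crux (it is neither easier nor harder); the line's only genuine cut is `stub_comparison ∧ stub_anchor`. -/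
theorem crux_iff_seedSubpoly {k : ℕ} (hk : 2 ≤ k) :
    PercNonProliferation.SubpolynomialBlocking ↔
      ∀ s : ℝ, 0 < s → ∀ᶠ n : ℕ in atTop, (n : ℝ) ^ (-s) ≤
        (bondPercolation (zdGraph 3) (criticalProbI 3)).real
          (openCrossing (Set.Icc (0 : Site 3) ![(n : ℤ), (n : ℤ) + (n / k : ℕ), (n : ℤ) + (n / k : ℕ)])
            {x | x ∈ Set.Icc (0 : Site 3) ![(n : ℤ), (n : ℤ) + (n / k : ℕ), (n : ℤ) + (n / k : ℕ)] ∧ x 0 = 0}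
            {y | y ∈ Set.Icc (0 : Site 3) ![(n : ℤ), (n : ℤ) + (n / k : ℕ), (n : ℤ) + (n / k : ℕ)] ∧
              y 0 = (n : ℤ)})ᶜ :=
  ⟨seedSubpoly_of_crux hk, crux_of_seedSubpoly (by omega)⟩

end Summit.CriticalPhenomena.PercolationContinuityZ3.Theorems.SubpolynomialBlocking

end
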